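import Summits.Ventures.WeilGRH.TwistedSechDensity
import Summits.Ventures.WeilGRH.TwistedWindowForm
import Summits.RiemannHypothesis.RiemannHypothesis.Theorems.WeilGroundStateGroundStateSimpleEvenStubMarkovConstant
import Mathlib.Analysis.SpecialFunctions.Gamma.Basic
import HarnessLib

/-!
# GRH arm (rh-explicit, venture WeilGRH): explicit constants for the flat-window inequality

Cell `rh-explicit`, WEIL TRACK (structure seat weil-3, gen7) for the GRH ARM.  The flat-window inequality
(`TwistedFlatTest.lean`): `WeilPositivityOnChar χ a ⟹ 2S_χ(a) + K_κ − I_κ(a)/a ≤ log q` with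

* the smoothed twisted prime sum `S_χ(a) = Σ_{log n<2a} Λ(n)n^{-1/2}(1 − log n/(2a)) Re χ(n)`,
* the archimedean constant `K_κ = log 4π + γ + 2∫₀^∞ (e^{(1/2−κ)t} − 1)dt/(2 sinh t)`,
* the archimedean cost of the flat window `I_κ(a) = ∫₀^∞ ρ_κ(t) min(t, 2a) dt`, `ρ_κ(t) = e^{(1/2−κ)t}/(2 sinh t)`.

This file makes the two archimedean quantities numerically legible (elementary bounds, no named facts):

* `flatWindow_const_zero_ge` / `flatWindow_const_one_ge`: **`K₀ ≥ 5.3716`** (true value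
  `log 8π + γ + π/2 = 5.37218…`; the tree's `GroundStateSimpleEven.mk_integral_weilKillingDensity_ge`) and
  **`K₁ ≥ 2.23`** (`K₁ = K₀ − π`, by `∫₀^∞ dt/(2cosh(t/2)) = π/2`, `TwistedSechDensity.lean`);
* `integral_weilArchDensityPar_mul_min_le_five`: **`I_κ(a) ≤ 5`** for every `a ≥ 0` and parity `κ`
  (`ρ_κ(t) min(t,2a) ≤ t ρ₀(t) ≤ e^{-t/2}(1 + 2t)/2` from `1 + 2t ≤ e^{2t}`, and
  `∫₀^∞ e^{-t/2}(1+2t)/2 dt = 1 + 4`; true values `∫₀^∞ tρ₀ = ψ′(¼)/4 = 4.2993…`, `I₀(1) = 2.79…`).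

Hence the NUMERICAL FLOOR of the flat-window inequality (`TwistedFlatTestFloor.lean`, after the core file
lands): a `χ`-rung at `a` forces `log q ≥ 2S_χ(a) + 2.23 − 5/a` (any parity), `≥ 2S_χ(a) + 5.3716 − 5/a`
(even `χ`).  RH/GRH-free.
-/

set_option autoImplicit false

noncomputable section

open Complex Filter Set MeasureTheory
open scoped Real Topology

namespace Summit.Ventures.WeilGRH

open Literature.NumberTheory.LFunctions

/-! ## The archimedean constants `K_0`, `K_1` -/

/-- The even killing density is the `ζ` one: `(e^{(1/2−0)t} − 1)/(2 sinh t) = (e^{t/2} − 1)/(2 sinh t)`. -/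
theorem weilKillingDensityPar_zero_eq (t : ℝ) :
    weilKillingDensityPar 0 t = (Real.exp (t / 2) - 1) / (2 * Real.sinh t) := by
  unfold weilKillingDensityPar
  rw [show ((1 : ℝ) / 2 - ((0 : ℕ) : ℝ)) * t = t / 2 by push_cast; ring]

/-- **`∫₀^∞ (e^{t/2} − 1)/(2 sinh t) dt ≥ 1.13195`** in the parity vocabulary (true value `π/4 + (log 2)/2`). -/
theorem integral_weilKillingDensityPar_zero_ge :
    (1.13195 : ℝ) ≤ ∫ t in Ioi (0 : ℝ), weilKillingDensityPar 0 t := by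
  rw [show (fun t ↦ weilKillingDensityPar 0 t) = fun t ↦ (Real.exp (t / 2) - 1) / (2 * Real.sinh t) from
    funext weilKillingDensityPar_zero_eq]
  exact Summit.RiemannHypothesis.RiemannHypothesis.Theorems.GroundStateSimpleEven.mk_integral_weilKillingDensity_ge

/-- **The odd killing integral is the even one minus `π/2`**:
`∫₀^∞ (e^{−t/2} − 1)/(2 sinh t) dt = ∫₀^∞ (e^{t/2} − 1)/(2 sinh t) dt − π/2` (`∫₀^∞ dt/(2cosh(t/2)) = π/2`). -/
theorem integral_weilKillingDensityPar_one_eq :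
    ∫ t in Ioi (0 : ℝ), weilKillingDensityPar 1 t =
      (∫ t in Ioi (0 : ℝ), weilKillingDensityPar 0 t) - π / 2 := by
  rw [← integral_sech_density_Ioi_zero,
    show (fun t ↦ weilKillingDensityPar 0 t) = fun t ↦ (Real.exp (t / 2) - 1) / (2 * Real.sinh t) from
      funext weilKillingDensityPar_zero_eq,
    ← integral_sub integrableOn_weilKillingDensity (integrableOn_sech_density_Ioi 0)]
  exact setIntegral_congr_fun measurableSet_Ioi fun t (ht : 0 < t) ↦ weilKillingDensityPar_one_eq ht.ne'

/-- `log 4π + γ ≥ 3.1077` (`log 4π + γ = 2 log 2 + log π + γ = 3.10824…`). [folklore] -/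
theorem log_four_pi_add_eulerMascheroni_ge :
    (3.1077 : ℝ) ≤ Real.log (4 * π) + Real.eulerMascheroniConstant := by
  have h2 : Real.log (4 * π) = 2 * Real.log 2 + Real.log π := by
    rw [Real.log_mul (by norm_num) Real.pi_pos.ne', show (4 : ℝ) = 2 ^ 2 by norm_num, Real.log_pow]
    push_cast; ring
  have h3 := Literature.Analysis.SpecialFunctions.Real.log_pi_gt_d20
  have h4 := Real.log_two_gt_d9
  have h5 := Literature.Analysis.SpecialFunctions.Real.eulerMascheroniConstant_gt_d8
  rw [h2]
  linarith

/-- **`K₀ ≥ 5.3716`**: the archimedean constant of the flat-window inequality for EVEN characters,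
`K₀ = log 4π + γ + 2∫₀^∞ (e^{t/2} − 1)dt/(2 sinh t) = log 8π + γ + π/2 = 5.37218…`. -/
theorem flatWindow_const_zero_ge :
    (5.3716 : ℝ) ≤ Real.log (4 * π) + Real.eulerMascheroniConstant +
      2 * ∫ t in Ioi (0 : ℝ), weilKillingDensityPar 0 t := by
  have h1 := integral_weilKillingDensityPar_zero_ge
  have h2 := log_four_pi_add_eulerMascheroni_ge
  linarith

/-- **`K₁ ≥ 2.23`**: the archimedean constant for ODD characters, `K₁ = K₀ − π = 2.23059…`. -/
theorem flatWindow_const_one_ge :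
    (2.23 : ℝ) ≤ Real.log (4 * π) + Real.eulerMascheroniConstant +
      2 * ∫ t in Ioi (0 : ℝ), weilKillingDensityPar 1 t := by
  rw [integral_weilKillingDensityPar_one_eq]
  have h1 := integral_weilKillingDensityPar_zero_ge
  have h2 := log_four_pi_add_eulerMascheroni_ge
  have h3 := Real.pi_lt_d6
  linarith

/-- **`K_κ ≥ 2.23` for every parity** (`κ = charParity χ ∈ {0, 1}`). -/
theorem flatWindow_const_ge {q : ℕ} (χ : DirichletCharacter ℂ q) :
    (2.23 : ℝ) ≤ Real.log (4 * π) + Real.eulerMascheroniConstant +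
      2 * ∫ t in Ioi (0 : ℝ), weilKillingDensityPar (charParity χ) t := by
  have hκ := charParity_le_one χ
  interval_cases h : charParity χ
  · linarith [flatWindow_const_zero_ge]
  · exact flatWindow_const_one_ge

/-! ## The archimedean cost of the flat window: `I_κ(a) ≤ 5` -/

/-- `t ρ₀(t) ≤ e^{-t/2}(1 + 2t)/2` for `t > 0` (from `1 + 2t ≤ e^{2t}`, i.e. `2 sinh t ≥ 2t e^{t}/(1+2t)·e^{-2t}…`). -/
theorem mul_weilArchDensity_le {t : ℝ} (ht : 0 < t) :
    t * weilArchDensity t ≤ Real.exp (-(1 / 2 * t)) * (1 + 2 * t) / 2 := by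
  unfold weilArchDensity
  have hs : 0 < 2 * Real.sinh t := mul_pos two_pos (Real.sinh_pos_iff.2 ht)
  have hsinh : 2 * Real.sinh t = Real.exp t - Real.exp (-t) := by rw [Real.sinh_eq]; ring
  rw [mul_div_assoc', div_le_iff₀ hs, hsinh]
  -- `t e^{t/2} ≤ e^{-t/2}(1+2t)/2 · (e^t − e^{-t})` ⟸ `(1 + 2t) e^{-t} ≤ e^{t}` ⟸ `1 + 2t ≤ e^{2t}`
  have hkey : 1 + 2 * t ≤ Real.exp (2 * t) := by
    have := Real.add_one_le_exp (2 * t); linarith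
  have e1 : Real.exp (-(1 / 2 * t)) * Real.exp t = Real.exp (t / 2) := by
    rw [← Real.exp_add]; congr 1; ring
  have e2 : Real.exp (-(1 / 2 * t)) * Real.exp (-t) = Real.exp (t / 2) * Real.exp (-(2 * t)) := by
    rw [← Real.exp_add, ← Real.exp_add]; congr 1; ring
  have e3 : Real.exp (2 * t) * Real.exp (-(2 * t)) = 1 := by rw [← Real.exp_add]; simp
  have hpos : 0 < Real.exp (t / 2) := Real.exp_pos _
  have hpos2 : 0 < Real.exp (-(2 * t)) := Real.exp_pos _
  -- multiply `hkey` by `e^{-2t}`: `(1+2t)e^{-2t} ≤ 1`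
  have hk2 : (1 + 2 * t) * Real.exp (-(2 * t)) ≤ 1 := by
    calc (1 + 2 * t) * Real.exp (-(2 * t)) ≤ Real.exp (2 * t) * Real.exp (-(2 * t)) :=
          mul_le_mul_of_nonneg_right hkey hpos2.le
      _ = 1 := e3
  calc t * Real.exp (t / 2) = Real.exp (t / 2) * (2 * t) / 2 := by ring
    _ ≤ Real.exp (t / 2) * ((1 + 2 * t) - (1 + 2 * t) * Real.exp (-(2 * t))) / 2 := by
        gcongr
        nlinarith
    _ = Real.exp (-(1 / 2 * t)) * (1 + 2 * t) / 2 * (Real.exp t - Real.exp (-t)) := by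
        have hx : Real.exp (-(1 / 2 * t)) * (1 + 2 * t) / 2 * (Real.exp t - Real.exp (-t)) =
            (Real.exp (-(1 / 2 * t)) * Real.exp t) * (1 + 2 * t) / 2 -
              (Real.exp (-(1 / 2 * t)) * Real.exp (-t)) * (1 + 2 * t) / 2 := by ring
        rw [hx, e1, e2]; ring

/-- The majorant integrates to `5`: `∫₀^∞ e^{-t/2}(1 + 2t)/2 dt = 1 + 4`. -/
theorem integral_flatWindow_archMajorant :
    ∫ t in Ioi (0 : ℝ), Real.exp (-(1 / 2 * t)) * (1 + 2 * t) / 2 = 5 := by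
  have h1 := Real.integral_rpow_mul_exp_neg_mul_Ioi (a := 1) (r := 1 / 2) one_pos (by norm_num)
  have h2 := Real.integral_rpow_mul_exp_neg_mul_Ioi (a := 2) (r := 1 / 2) two_pos (by norm_num)
  rw [sub_self, Real.Gamma_one, mul_one] at h1
  rw [show (2 : ℝ) - 1 = 1 by norm_num, Real.Gamma_two, mul_one] at h2
  have h1' : ∫ t in Ioi (0 : ℝ), Real.exp (-(1 / 2 * t)) = 2 := by
    rw [← setIntegral_congr_fun measurableSet_Ioi
      (fun t (ht : 0 < t) ↦ by rw [Real.rpow_zero, one_mul] :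
        ∀ t ∈ Ioi (0:ℝ), t ^ (0 : ℝ) * Real.exp (-(1 / 2 * t)) = Real.exp (-(1 / 2 * t))), h1]
    norm_num
  have h2' : ∫ t in Ioi (0 : ℝ), t * Real.exp (-(1 / 2 * t)) = 4 := by
    rw [← setIntegral_congr_fun measurableSet_Ioi
      (fun t (ht : 0 < t) ↦ by rw [Real.rpow_one] :
        ∀ t ∈ Ioi (0:ℝ), t ^ (1 : ℝ) * Real.exp (-(1 / 2 * t)) = t * Real.exp (-(1 / 2 * t))), h2]
    norm_num
  have hi1 : IntegrableOn (fun t : ℝ ↦ Real.exp (-(1 / 2 * t))) (Ioi 0) :=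
    Integrable.of_integral_ne_zero (by rw [h1']; norm_num)
  have hi2 : IntegrableOn (fun t : ℝ ↦ t * Real.exp (-(1 / 2 * t))) (Ioi 0) :=
    Integrable.of_integral_ne_zero (by rw [h2']; norm_num)
  have hsplit : (fun t : ℝ ↦ Real.exp (-(1 / 2 * t)) * (1 + 2 * t) / 2) =
      fun t ↦ (1 / 2) * Real.exp (-(1 / 2 * t)) + t * Real.exp (-(1 / 2 * t)) := by
    funext t; ring
  rw [hsplit, integral_add (hi1.const_mul _) hi2, integral_const_mul, h1', h2']
  norm_num

/-- The majorant is integrable on `(0, ∞)`. -/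
theorem integrableOn_flatWindow_archMajorant :
    IntegrableOn (fun t : ℝ ↦ Real.exp (-(1 / 2 * t)) * (1 + 2 * t) / 2) (Ioi 0) :=
  Integrable.of_integral_ne_zero (by rw [integral_flatWindow_archMajorant]; norm_num)

/-- **`I_κ(a) ≤ 5`**: the archimedean cost of the flat window, `∫₀^∞ ρ_κ(t) min(t, 2a) dt ≤ 5` for
every `a ≥ 0` and every parity `κ` (`ρ_κ ≤ ρ₀`, `min(t,2a) ≤ t`, `tρ₀(t) ≤ e^{-t/2}(1+2t)/2`). -/
theorem integral_weilArchDensityPar_mul_min_le_five (κ : ℕ) {a : ℝ} (ha : 0 ≤ a) :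
    ∫ t in Ioi (0 : ℝ), weilArchDensityPar κ t * min t (2 * a) ≤ 5 := by
  rw [← integral_flatWindow_archMajorant]
  refine integral_mono_of_nonneg ?_ integrableOn_flatWindow_archMajorant ?_
  · refine (ae_restrict_iff' measurableSet_Ioi).2 (Eventually.of_forall fun t (ht : 0 < t) ↦ ?_)
    exact mul_nonneg (weilArchDensityPar_nonneg_le κ ht).1 (le_min ht.le (by linarith))
  · refine (ae_restrict_iff' measurableSet_Ioi).2 (Eventually.of_forall fun t (ht : 0 < t) ↦ ?_)
    obtain ⟨h0, hle⟩ := weilArchDensityPar_nonneg_le κ ht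
    calc weilArchDensityPar κ t * min t (2 * a) ≤ weilArchDensity t * t :=
          mul_le_mul hle (min_le_left _ _) (le_min ht.le (by linarith)) (weilArchDensity_pos ht).le
      _ = t * weilArchDensity t := mul_comm _ _
      _ ≤ Real.exp (-(1 / 2 * t)) * (1 + 2 * t) / 2 := mul_weilArchDensity_le ht

/-- `I_κ(a) ≥ 0`. -/
theorem integral_weilArchDensityPar_mul_min_nonneg (κ : ℕ) {a : ℝ} (ha : 0 ≤ a) :
    0 ≤ ∫ t in Ioi (0 : ℝ), weilArchDensityPar κ t * min t (2 * a) :=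
  setIntegral_nonneg measurableSet_Ioi fun t (ht : 0 < t) ↦
    mul_nonneg (weilArchDensityPar_nonneg_le κ ht).1 (le_min ht.le (by linarith))

end Summit.Ventures.WeilGRH

end
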